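import Literature.MathematicalPhysics.QuantumFieldTheory.Dimock2011to13.QED3WalkLocality
import Literature.MathematicalPhysics.QuantumFieldTheory.Dimock2011to13.QED3BlockPotentialSumsTorus
import Literature.MathematicalPhysics.QuantumFieldTheory.Dimock2011to13.QED3TorusPartitionOfUnity
import Literature.MathematicalPhysics.QuantumFieldTheory.Dimock2011to13.RandomWalkTorusDecay
import Literature.MathematicalPhysics.QuantumFieldTheory.Dimock2011to13.TorusCubeLayers
import HarnessLib

/-!
# Dimock, *QED on the 3-torus. II*, §3.2 THEOREM 1 (132)–(135), single scale, ON THE DISCRETE TORUS — Remark 3: «It is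
# possible that `Λ` is a sequence of the full tori, i.e. `Λ_i = T⁰_{N+M−i}`. In this case `d_Λ(x,y) = d(x,y)`» — the
# tree's abstract `dimock_thm1` INSTANTIATED on the periodic carrier `(ℤ∕N)^d`: blocks, one-point sums, cube adjacency
# («touch, possibly only on corners», wrap-around included), path counts `3^d` and the operator supports ALL CONCRETE;
# with the printed profiles (THEOREM 1: `d′^{−2}`; THEOREM 2 (195), bosons: `d′^{−1}`, `d′^{−1} + d′^{−2}`) and `h_□ := (124)`

statement-level skeleton of published theorems with citation tags; proofs where landed; nothing here is a claim about the Yang–Mills mass gap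

**Citation header (reproduction of PUBLISHED work).** J. Dimock, *Quantum electrodynamics on the 3-torus. II. The
renormalization group flow*, arXiv:math-ph/0407063 (2004) [Dimock2004QED3TorusII], **§3.2 THEOREM 1** (132)–(135)
p.22 L2–21 with **Remark 3** p.22 L28–30, proof Parts I and III p.23 L1–58, p.24 L59 – p.25 L12; §3.1 (126) p.21
L11–15; of the held arXiv text layer `paper:arxiv-math-ph_0407063` (`p.NN Lnn` = PDF page ∕ text-layer line).  Writer
seat p11 (literature-prover-lit-balaban-p11-g24-0), YM LIT SWEEP item (c) D13 (row C13 «WHERE»; zero weight for the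
YM-INPRINT tokens).  Imports the tree's `QED3WalkLocality` (§1 there: `H_mul_Kz_eq_zero`, `link0_eq_zero_of_apply`,
`linkR_eq_zero_of`; through it `QED3WalkExpansionInverse.dimock_thm1`), `RandomWalkTorusDecay` (the periodic distance
`torusDist` on `TPt d N = (ℤ∕N)^d` and the one-point sum `sum_exp_torusDist_le`) and `TorusCubeLayers` (through it
`RegionVolume`: the sup-norm balls `tball`, `card_tball_le`, the block map `czmap`, `czmap_mem_tball`; `mem_tball_comm`)
and `QED3BlockPotentialSumsTorus` (LEMMA 1 (130) ∕ (154) on the torus: `hconv_shape_torus`), `QED3TorusPartitionOfUnity`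
((124)–(126) periodized: `sum_sq_g_torus_eq_one`, `mem_tball_of_g_torus_ne_zero`).

**The printed text.**  THEOREM 1 p.22 L12–21: *"… Then `S_{k,Λ}(A,x,y)` exists and has the random walk expansion
(132). We have the bound for each path (134) and the bound for the full propagator `|S_{k,Λ}(A,x,y)| ≤
O(1)d′(x,y)^{−2}exp(−O(1)d_Λ(x,y))` (135)"*.  Remark 3 p.22 L28–30: *"It is possible that `Λ` is a sequence of the full
tori, i.e. `Λ_i = T⁰_{N+M−i}`. In this case `d_Λ(x,y) = d(x,y)` and we have the result (53) for `S_k(A,x,y)`."*  (132)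
p.22 L7–11: *"a path `ω` is a sequence of adjacent cubes (blocks) `□_0,…,□_n` from `D` … `□_j, □_{j+1}` should touch,
possibly only on corners, and including the possibility `□_j = □_{j+1}`. The notation `ω : x → y` means `x ∈ □̃_0`,
`y ∈ □̃_n`."*  p.24 L94–95: *"Now use `d_Λ(x_i,x_{i+1}) ≥ d_Λ(Δ_i,Δ_{i+1}) − 2` where the distance is from the center of
the cubes."*  p.25 L3–12: (155) *"For this see [7], lemma 2.1. … For the bound on `S_{k,Λ}(A,x,y)` we sum over paths.
The factor `(O(1)M_0)^{−n}` is sufficient to control the sum if `M_0` is sufficiently large."*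

**What is formalized (kernel-checked, zero `sorry`, no named facts).**  On the full torus the regions
disappear (Remark 3): one scale, unit blocks `Δ`, cubes `□` of `M₀` blocks, `d_Λ = d`.  The tree's `dimock_thm1`
(`QED3WalkExpansionInverse`) assembles THEOREM 1 from the printed analytic input over an ABSTRACT geometry (a
pseudo-metric `d`, blocks with centres, a one-point sum `K`, an adjacency with `≤ ν` neighbours, start cubes); its box
member `dimock_thm1_lattice` ∕ `dimock_thm1_supported` indexes cubes in `ℤ^ι` without periodic identification.  This
file gives the PERIODIC member on the cell's carrier `TPt d N = (ℤ∕N)^d` (`Balaban1983to89.TreeLengthTorus`):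
* §1 torus geometry — `torusDist_self'`, `torusDist_comm'` (the periodic ℓ¹ distance of `RandomWalkTorusDecay` is a
  pseudo-metric); `card_filter_mem_tball_le` (at most `(2s+1)^d` cubes have index in a sup-ball of radius `s`; `3^d`
  for the printed adjacency); the lattice of cube ANCHORS `anc □ = M₀·□ + c₀` in the block torus `TPt d (M₀N_c)` with
  `czmap_anchor` (the anchor block lies in its cube) and the ALIGNED WITNESS LEMMA `mem_tball_one_of_anchor` (two
  anchors within sup-distance `< 2M₀` on the block torus have cube indices within `1` on the cube torus — wrap-around
  included);
* §2 supports ⟹ locality of the walk — for multiplication operators `H □ = diagonal(h_□)` with `supp h_□ ⊂ anc(□)^{∼R}`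
  (the printed «`supp h_□ ⊂ □̃`», in blocks) and `A(x,y) ≠ 0 ⟹ Δ_y ∈ Δ_x^{∼ρ}`: **`h_□R_{□′} = 0` unless
  `cidx □′ ∈ (cidx □)^{∼1}`** (`H_mul_Kz_eq_zero_of_far_torus`, from `2R + ρ < 2M₀`), «`h_□h_□′ = 0` unless `□, □′`
  touch» (`H_mul_H_eq_zero_of_far_torus`, `R < M₀`), and both kinds of links at a site `x` vanish unless `□` is within
  `1` of the cube `czmap M₀ N_c (Δ_x)` of `x` (`link0_eq_zero_of_far_torus`, `linkR_eq_zero_of_far_torus`, from `R < M₀`,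
  `R + ρ < M₀` by `czmap_mem_tball`);
* §3 **`dimock_thm1_torus`**: THEOREM 1 single scale on the torus — `dimock_thm1` with `d(u,v) := torusDist (Δ_u) (Δ_v)`
  (block level, *"the distance is from the center of the cubes"*), blocks `B := TPt d N_b` (all unit blocks, `r = 0`),
  `K := K₁(d, c∕2)` by `sum_exp_torusDist_le` (uniform in the volume), adjacency `cidx □′ ∈ (cidx □)^{∼1}` with
  `ν = 3^d`, and `hadj`, `S₀`, `hS₀`, `hS₀card`, `S₁`, `hS₁`, `hS₁card` DISCHARGED as in §2; *"`M_0` sufficiently large"*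
  = `2·3^d·C₁θK₁(d,c∕2) ≤ M₀` together with the support ∕ range conditions `2R + ρ < 2M₀`, `R + ρ < M₀`.
  Conclusions: every entry series `Σ_n(S*Rⁿ)(x,y)` converges, `A·S_k(A) = 1`, and **(135)**
  `‖S_k(A;x,y)‖ ≤ 2·3^d·C₀·P₀(x,y)e^{−(c∕2)d(Δ_x,Δ_y)}`.
* §4 **`dimock_thm1_torus_dprime`** (`d = 3`): the same with THE PRINTED PROFILES `P₀ = Q = d′^{−2}` ((137), (143) on one
  scale) — as kernels against `∫dy = Ση³`: `η³·d′_T(e u,e v)^{−2}` with the periodic `d′_T` of `QED3BlockPotentialSumsTorus`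
  on the site torus `(ℤ∕N_s)³` (`e : X → TPt 3 N_s` injective, blocks of `≤ R³` sites) — and the block convolution
  hypotheses (154) `hconv`, `hconv₀` DISCHARGED by `hconv_shape_torus` ((130) on the torus), `θ = 2³C(2)(ηR)`; what
  remains is (125), (136), (137), (143) and the supports.  **`dimock_thm2_torus_dprime`**: the same engine for
  **THEOREM 2 (195)** (bosons, §3.3: *"Now we follow the proof of theorem 1. The only difference is in the short distance
  estimates"*) with the printed profiles `P₀ = d′^{−1}` ((198)) and `Q = d′^{−1} + d′^{−2}` ((201), one scale), (202) ∕ (203)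
  DISCHARGED by `hconv_shape_torus_boson` ∕ `hconv₀_shape_torus_boson`.
* §5 **`dimock_thm1_torus_printed`** (`d = 3`, all cubes `Z = (ℤ∕N_c)³`): the same with, IN ADDITION, **`h_□ :=` the printed
  (124) periodized on the torus** (`QED3TorusPartitionOfUnity`: `h_w(x) = g(ℓ^{−1}·valMinAbs(e x − cz w) − t)`, `g` the
  tree's constructed bump, `cz w = ℓ·w` the cube corner, `ℓ = ℓ_bM₀` sites per cube side, `t` within `1∕2ℓ` of the centre
  offset `τ∕ℓ`): **(125) `Σ_□h_□h_□ = 1` DERIVED** (`h125_torus` from `sum_sq_g_torus_eq_one`, three or more cubes per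
  direction) and the support hypothesis DERIVED («`supp h_□ ⊂ □̃`»: `mem_tball_of_g_torus_ne_zero` at site level, moved to
  the blocks by `czmap_mem_tball`), the range of `A` given at SITE level (`A(x,y) ≠ 0 ⟹ e y ∈ (e x)^{∼ρ_s}`).  What remains
  hypothesis: (136), the link bounds (137) ∕ (143) in printed shape, and the explicit largeness ∕ range arithmetic
  (*"`M_0` sufficiently large"*).

**Readings (declared).**  (i) The printed `d(x,y) = |x − y|` (sup metric, paper I (21)) is carried by the periodic ℓ¹
distance between the unit blocks of `x` and `y`: `d_∞ ≤ d_1 ≤ d·d_∞` on `(ℤ∕N)^d` and `|d(x,y) − d(Δ_x,Δ_y)| ≤ 1`, both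
absorbed in the printed `O(1)`'s of (134)–(135); the input link bounds (137) ∕ (143) are taken in the same currency.
(ii) Cube indices live on the cube torus `TPt d N_c`, block indices on `TPt d N_b`, `N_b = M₀N_c`; the anchor offset
`c₀ ∈ [0,M₀)^d` is free (centre or corner).  (iii) `M₀` is both the cube side in blocks and the `M₀` of (143):
on one scale `L^{k−i} = 1`.

**Honest scope.**  HYPOTHESES, in printed shape: (125) `Σ_□h_□² = 1` (`h125`), (136) (`h136`), the link bounds (137) ∕
(143) (`h0`, `hR`), the block convolution bounds (154) for `(Q,Q)` and `(P₀,Q)` (`hconv`, `hconv₀`; DISCHARGED in §4 for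
the printed profile `d′^{−2}`), the block-level support of `h_□` and range of `A` (both DERIVED in §5 for the periodized
(124) and a site-level range).  The multiscale THEOREM 1 (regions `δΛ_i`, the metric (127), Bałaban's Lemma 2.1
for (155)) is NOT touched here; the periodized (124) and its (125) used in §5 are those of `QED3TorusPartitionOfUnity`
(imported), not re-derived here; LEMMA 2 ((136)–(137)) and Part II ((143)) stay hypotheses in this file (Part II on the
torus: the later `QED3CommutatorBoundsTorus`).  No `d = 4` statement;
nothing about Bałaban's papers beyond the reuse of the cell's torus carrier as geometry.

**Version.**  v1.1 — DOC-ONLY: the honest-scope sentence on the periodized (124) ∕ (125) corrected (they come from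
`QED3TorusPartitionOfUnity` and are used in §5); every declaration of v1 (p356695, commit 1c44affe53c1) byte-identical.
-/

noncomputable section

namespace Literature.MathematicalPhysics.QuantumFieldTheory.Dimock2011to13

namespace QED3TorusII

open Finset Real
open RandomWalkExpansion (Kz Gstar Kop)
open Balaban1983to89.B13ScaleTransfer (Pt coarse coarse_eq_iff)
open Balaban1983to89.TreeLengthTorus (TPt proj natLift proj_natLift)
open Balaban1983to89.TreeLengthTorusGeometry (period proj_add_period exists_period_of_proj_eq)
open Balaban1983to89.B12Decay510Window (K₁)
open Balaban1983to89.B12Decay510Torus (pl1 pl1_eq_sum pabs pabs_zero pl1_sub_comm)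
open RandomWalkTorusDecay (torusDist torusDist_nonneg torusDist_triangle sum_exp_torusDist_le)
open RegionVolume (box mem_box tball mem_tball mem_tball_add self_mem_tball card_tball_le proj_add czmap czmap_proj
  czmap_mem_tball)
open TorusCubeLayers (mem_tball_comm)

/-! ## §1 Torus geometry: the periodic distance, counts in sup-balls, cube anchors -/

section Geometry

variable {d : ℕ} {Nb : ℕ} [NeZero Nb]

omit [NeZero Nb] in
/-- the periodic distance of a block to itself vanishes. [cite: Dimock2004QED3TorusII, §3.2 Thm 1 Remark 3 p.22 L28–30 («d_Λ(x,y) = d(x,y)»)] -/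
theorem torusDist_self' (b : TPt d Nb) : torusDist b b = 0 := by
  show pl1 (b - b) = 0
  rw [sub_self, pl1_eq_sum]
  exact sum_eq_zero fun i _ => by simp [pabs_zero]

omit [NeZero Nb] in
/-- the periodic distance is symmetric. [cite: Dimock2004QED3TorusII, §3.2 Thm 1 Remark 3 p.22 L28–30] -/
theorem torusDist_comm' (b b' : TPt d Nb) : torusDist b b' = torusDist b' b := by
  show pl1 (b - b') = pl1 (b' - b)
  exact pl1_sub_comm _ _

variable {Nc : ℕ} [NeZero Nc]

omit [NeZero Nb] [NeZero Nc] in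
/-- **path counts on the torus**: at most `(2s+1)^d` cubes (indexed injectively in the cube torus) have index in a sup-ball
of radius `s` — for `s = 1` the `3^d` neighbours of the printed adjacency *"touch, possibly only on corners, and including
the possibility `□_j = □_{j+1}`"*. [cite: Dimock2004QED3TorusII, §3.2 (132) p.22 L7–11 and Thm 1 proof Part III p.25 L10–12] -/
theorem card_filter_mem_tball_le {Z : Type*} [Fintype Z] (cidx : Z → TPt d Nc) (hcidx : Function.Injective cidx)
    (t : TPt d Nc) (s : ℕ) : (univ.filter fun z => cidx z ∈ tball t s).card ≤ (2 * s + 1) ^ d := by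
  refine le_trans ?_ (card_tball_le t s)
  refine card_le_card_of_injOn cidx (fun z hz => ?_) (hcidx.injOn)
  exact (mem_filter.1 (mem_coe.1 hz)).2

variable {M₀ : ℕ} [NeZero M₀]

/-- **the anchor block of a cube lies in the cube**: with `anc □ = M₀·□ + c₀` (standard lift, `0 ≤ c₀ < M₀`
coordinatewise) on the block torus `N_b = M₀N_c`, the block map `czmap M₀ N_c` sends `anc □` to `□`.
[cite: Dimock2004QED3TorusII, §3.1 (126) p.21 L11–15] -/
theorem czmap_anchor (hmod : Nb = M₀ * Nc) {c₀ : Pt d} (hc₀ : ∀ i, 0 ≤ c₀ i ∧ c₀ i < M₀)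
    {anc : TPt d Nc → TPt d Nb} (hanc : ∀ w, anc w = proj Nb fun i => (M₀ : ℤ) * natLift w i + c₀ i)
    (w : TPt d Nc) : czmap M₀ Nc (anc w) = w := by
  have hM₀ : 0 < M₀ := Nat.pos_of_ne_zero (NeZero.ne M₀)
  rw [hanc w, czmap_proj hmod, (coarse_eq_iff hM₀ _ (natLift w)).2 fun i => ?_, proj_natLift]
  obtain ⟨h1, h2⟩ := hc₀ i
  constructor
  · linarith
  · linarith

omit [NeZero Nb] in
/-- **the aligned witness lemma on the torus**: two anchors within sup-distance `s < 2M₀` on the block torus have cube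
indices within sup-distance `1` on the cube torus (wrap-around included: the block period `N_b = M₀N_c` is `M₀` times the
cube period). [cite: Dimock2004QED3TorusII, §3.2 (132) p.22 L7–11 and Thm 1 proof Part I p.23 L54–55] -/
theorem mem_tball_one_of_anchor (hmod : Nb = M₀ * Nc) (c₀ : Pt d)
    {anc : TPt d Nc → TPt d Nb} (hanc : ∀ w, anc w = proj Nb fun i => (M₀ : ℤ) * natLift w i + c₀ i)
    {w w' : TPt d Nc} {s : ℕ} (hs : s < 2 * M₀) (h : anc w' ∈ tball (anc w) s) : w' ∈ tball w 1 := by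
  have hM₀ : 0 < M₀ := Nat.pos_of_ne_zero (NeZero.ne M₀)
  have hM₀z : (0 : ℤ) < M₀ := by exact_mod_cast hM₀
  obtain ⟨v, hv, hv'⟩ := mem_tball.1 h
  rw [hanc w, hanc w', ← proj_add] at hv'
  obtain ⟨k, hk⟩ := exists_period_of_proj_eq hv'
  -- the box vector `v` is `M₀` times an integer vector `t`
  set t : Pt d := fun i => natLift w' i - natLift w i + (Nc : ℤ) * k i with ht
  have hvt : ∀ i, v i = (M₀ : ℤ) * t i := by
    intro i
    have e := congrFun hk i
    simp only [Pi.add_apply, period, hmod, Nat.cast_mul] at e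
    simp only [ht]
    linear_combination e
  have htbox : t ∈ box d 1 := by
    refine mem_box.2 fun i => ?_
    obtain ⟨h1, h2⟩ := mem_box.1 hv i
    have hs' : (s : ℤ) < 2 * M₀ := by exact_mod_cast hs
    rw [hvt i] at h1 h2
    constructor
    · by_contra hlt
      rw [not_le] at hlt
      have : t i ≤ -2 := by omega
      nlinarith
    · by_contra hlt
      rw [not_le] at hlt
      have : 2 ≤ t i := by omega
      nlinarith
  refine mem_tball.2 ⟨t, htbox, ?_⟩
  have e1 : natLift w' = (natLift w + t) + period Nc (-k) := by
    funext i
    simp only [Pi.add_apply, Pi.neg_apply, period, ht]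
    ring
  calc w' = proj Nc (natLift w') := (proj_natLift w').symm
    _ = proj Nc (natLift w + t) := by rw [e1, proj_add_period]
    _ = w + proj Nc t := by rw [proj_add, proj_natLift]

end Geometry

/-! ## §2 Supports and range on the torus ⟹ `hadj`, `hS₀`, `hS₁` -/

section Supports

variable {d : ℕ} {Nb Nc M₀ : ℕ} [NeZero Nb] [NeZero Nc] [NeZero M₀]
variable {X : Type*} [Fintype X] [DecidableEq X] {E : Type*} [Ring E]
variable {Z : Type*} {φ : Z → X → E} {H : Z → Matrix X X E}
variable {β : X → TPt d Nb} {cidx : Z → TPt d Nc} {c₀ : Pt d} {anc : TPt d Nc → TPt d Nb} {Rb ρb : ℕ}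
variable {A : Matrix X X E}

omit [NeZero Nb] in
/-- **`h_□R_{□′} = 0` unless `□, □′` are adjacent on the cube torus** (`cidx □′ ∈ (cidx □)^{∼1}`): for `supp h_□ ⊂
anc(□)^{∼R}` («`supp h_□ ⊂ □̃`», blocks) and `A(x,y) ≠ 0 ⟹ Δ_y ∈ Δ_x^{∼ρ}`, when `2R + ρ < 2M₀` — the hypothesis `hadj` of
the tree's `dimock_thm1`, periodic. [cite: Dimock2004QED3TorusII, §3.2 Thm 1 proof Part I p.23 L54–55 with (132) p.22 L7–11 and §3.1 (126) p.21 L11–15] -/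
theorem H_mul_Kz_eq_zero_of_far_torus (hH : ∀ z, H z = Matrix.diagonal (φ z)) (hmod : Nb = M₀ * Nc)
    (hanc : ∀ w, anc w = proj Nb fun i => (M₀ : ℤ) * natLift w i + c₀ i)
    (hφ : ∀ z x, φ z x ≠ 0 → β x ∈ tball (anc (cidx z)) Rb)
    (hA : ∀ x y, A x y ≠ 0 → β y ∈ tball (β x) ρb) (hRρ : 2 * Rb + ρb < 2 * M₀)
    {z z' : Z} (hfar : cidx z' ∉ tball (cidx z) 1) : H z * Kz A H z' = 0 := by
  apply H_mul_Kz_eq_zero hH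
  intro x y hx hAxy
  by_contra hcon
  apply hfar
  rcases not_and_or.1 hcon with h | h
  · have h1 : anc (cidx z') ∈ tball (anc (cidx z)) (Rb + Rb) :=
      mem_tball_add (hφ z x hx) (mem_tball_comm.1 (hφ z' x h))
    exact mem_tball_one_of_anchor hmod c₀ hanc (by omega) h1
  · have h1 : anc (cidx z') ∈ tball (anc (cidx z)) (Rb + ρb + Rb) :=
      mem_tball_add (mem_tball_add (hφ z x hx) (hA x y hAxy)) (mem_tball_comm.1 (hφ z' y h))
    exact mem_tball_one_of_anchor hmod c₀ hanc (by omega) h1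

omit [NeZero Nb] in
/-- **«`h_□h_□′ = 0` unless `□, □′` touch»** on the torus (`R < M₀`). [cite: Dimock2004QED3TorusII, §3.1 p.21 L10] -/
theorem H_mul_H_eq_zero_of_far_torus (hH : ∀ z, H z = Matrix.diagonal (φ z)) (hmod : Nb = M₀ * Nc)
    (hanc : ∀ w, anc w = proj Nb fun i => (M₀ : ℤ) * natLift w i + c₀ i)
    (hφ : ∀ z x, φ z x ≠ 0 → β x ∈ tball (anc (cidx z)) Rb) (hRM : Rb < M₀)
    {z z' : Z} (hfar : cidx z' ∉ tball (cidx z) 1) : H z * H z' = 0 := by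
  apply H_mul_H_eq_zero hH
  intro x
  by_contra hcon
  obtain ⟨h1, h2⟩ := not_or.1 hcon
  exact hfar (mem_tball_one_of_anchor hmod c₀ hanc (by omega : Rb + Rb < 2 * M₀)
    (mem_tball_add (hφ z x h1) (mem_tball_comm.1 (hφ z' x h2))))

omit [Fintype X] [DecidableEq X] in
/-- a cube whose `h_□` sees the site `x` is within `1` of the cube of `x` (the block map of `Δ_x`), for `R < M₀`
(*"vanishes unless `x ∈ supp h_{□_0} ⊂ □̃_0`"*). [cite: Dimock2004QED3TorusII, §3.2 (132) p.22 L10–11 and Thm 1 proof Part I p.23 L55–56] -/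
theorem mem_tball_czmap_of_apply_ne_zero (hmod : Nb = M₀ * Nc) (hc₀ : ∀ i, 0 ≤ c₀ i ∧ c₀ i < M₀)
    (hanc : ∀ w, anc w = proj Nb fun i => (M₀ : ℤ) * natLift w i + c₀ i)
    (hφ : ∀ z x, φ z x ≠ 0 → β x ∈ tball (anc (cidx z)) Rb) (hRM : Rb < M₀)
    {z : Z} {x : X} (hx : φ z x ≠ 0) : cidx z ∈ tball (czmap M₀ Nc (β x)) 1 := by
  have h1 : anc (cidx z) ∈ tball (β x) Rb := mem_tball_comm.1 (hφ z x hx)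
  have h2 := czmap_mem_tball (Ls := M₀) (Nc := Nc) hmod h1
  rwa [czmap_anchor hmod hc₀ hanc, Nat.div_eq_of_lt hRM, zero_add] at h2

omit [Fintype X] [DecidableEq X] in
/-- a cube whose `h_□` sees an `A`-neighbour of `x` is within `1` of the cube of `x`, for `R + ρ < M₀`.
[cite: Dimock2004QED3TorusII, §3.2 (132) p.22 L10–11 and Thm 1 proof Part I p.23 L54–56] -/
theorem mem_tball_czmap_of_near (hmod : Nb = M₀ * Nc) (hc₀ : ∀ i, 0 ≤ c₀ i ∧ c₀ i < M₀)
    (hanc : ∀ w, anc w = proj Nb fun i => (M₀ : ℤ) * natLift w i + c₀ i)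
    (hφ : ∀ z x, φ z x ≠ 0 → β x ∈ tball (anc (cidx z)) Rb)
    (hA : ∀ x y, A x y ≠ 0 → β y ∈ tball (β x) ρb) (hRρ' : Rb + ρb < M₀)
    {z : Z} {x u : X} (hxu : A x u ≠ 0) (hu : φ z u ≠ 0) : cidx z ∈ tball (czmap M₀ Nc (β x)) 1 := by
  have h1 : anc (cidx z) ∈ tball (β x) (ρb + Rb) := mem_tball_add (hA x u hxu) (mem_tball_comm.1 (hφ z u hu))
  have h2 := czmap_mem_tball (Ls := M₀) (Nc := Nc) hmod h1
  rwa [czmap_anchor hmod hc₀ hanc, Nat.div_eq_of_lt (by omega), zero_add] at h2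

/-- **the first link at `x` lives on the cubes next to the cube of `x`** (torus): `(h_□S*_□h_□)(x,·) = 0` unless
`cidx □ ∈ (czmap M₀ N_c Δ_x)^{∼1}` — `hS₀`, `hS₀near` of the tree's `dimock_thm1`.
[cite: Dimock2004QED3TorusII, §3.2 Thm 1 proof Part I p.23 L55–56] -/
theorem link0_eq_zero_of_far_torus (hH : ∀ z, H z = Matrix.diagonal (φ z)) (hmod : Nb = M₀ * Nc)
    (hc₀ : ∀ i, 0 ≤ c₀ i ∧ c₀ i < M₀) (hanc : ∀ w, anc w = proj Nb fun i => (M₀ : ℤ) * natLift w i + c₀ i)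
    (hφ : ∀ z x, φ z x ≠ 0 → β x ∈ tball (anc (cidx z)) Rb) (hRM : Rb < M₀)
    (G : Z → Matrix X X E) {z : Z} {x : X} (hfar : cidx z ∉ tball (czmap M₀ Nc (β x)) 1) (v : X) :
    link0 H G z x v = 0 := by
  refine link0_eq_zero_of_apply hH G ?_ v
  by_contra hx
  exact hfar (mem_tball_czmap_of_apply_ne_zero hmod hc₀ hanc hφ hRM hx)

/-- **a later link at `x` lives on the cubes next to the cube of `x`** (torus): `(R_□S*_□h_□)(x,·) = 0` unless
`cidx □ ∈ (czmap M₀ N_c Δ_x)^{∼1}` — `hS₁`, `hS₁near` of the tree's `dimock_thm1`.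
[cite: Dimock2004QED3TorusII, §3.2 Thm 1 proof Part I (140)–(142) p.23 L18–56] -/
theorem linkR_eq_zero_of_far_torus (hH : ∀ z, H z = Matrix.diagonal (φ z)) (hmod : Nb = M₀ * Nc)
    (hc₀ : ∀ i, 0 ≤ c₀ i ∧ c₀ i < M₀) (hanc : ∀ w, anc w = proj Nb fun i => (M₀ : ℤ) * natLift w i + c₀ i)
    (hφ : ∀ z x, φ z x ≠ 0 → β x ∈ tball (anc (cidx z)) Rb)
    (hA : ∀ x y, A x y ≠ 0 → β y ∈ tball (β x) ρb) (hRM : Rb < M₀) (hRρ' : Rb + ρb < M₀)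
    (G : Z → Matrix X X E) {z : Z} {x : X} (hfar : cidx z ∉ tball (czmap M₀ Nc (β x)) 1) (v : X) :
    linkR A H G z x v = 0 := by
  refine linkR_eq_zero_of hH G ?_ (fun u hxu => ?_) v
  · by_contra hx
    exact hfar (mem_tball_czmap_of_apply_ne_zero hmod hc₀ hanc hφ hRM hx)
  · by_contra hu
    exact hfar (mem_tball_czmap_of_near hmod hc₀ hanc hφ hA hRρ' hxu hu)

end Supports

/-! ## §3 THEOREM 1, single scale, on the torus -/

section Theorem1

variable {d : ℕ} {Nb Nc M₀ : ℕ} [NeZero Nb] [NeZero Nc] [NeZero M₀]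
variable {X : Type*} [Fintype X] [DecidableEq X] {E : Type*} [NormedRing E] [NormedAlgebra ℝ E]
variable {Z : Type*} [Fintype Z] [DecidableEq Z]

/-- **THEOREM 1 (132)–(135), single scale, ON THE TORUS (Remark 3).**  Sites `X` with their unit blocks
`Δ : X → (ℤ∕N_b)^d` (a site `ctr b` in every block), cubes `Z` indexed injectively in the cube torus `(ℤ∕N_c)^d`,
`N_b = M₀N_c`, anchors `anc □ = M₀·□ + c₀`; multiplication operators `H □ = diagonal(h_□)` with `supp h_□ ⊂ anc(□)^{∼R}`
and `A(x,y) ≠ 0 ⟹ Δ_y ∈ Δ_x^{∼ρ}`, `2R + ρ < 2M₀`, `R + ρ < M₀`; the printed analytic input (125), (136), (137) ∕ (143)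
with profiles `P₀`, `Q` and decay `e^{−c·d(Δ_u,Δ_v)}`, (154) for `(Q,Q)` and `(P₀,Q)` over the unit blocks; and *"`M_0`
sufficiently large"*: `2·3^d·C₁θK₁(d,c∕2) ≤ M₀`.  THEN every entry series of the walk expansion converges,
`A·S_k(A) = 1`, and (135) `‖S_k(A;x,y)‖ ≤ 2·3^d·C₀·P₀(x,y)e^{−(c∕2)d(Δ_x,Δ_y)}` — by the tree's `dimock_thm1` with
`d := torusDist ∘ Δ`, `B :=` all unit blocks (`r = 0`), `K := K₁(d,c∕2)` (`sum_exp_torusDist_le`), `adj □ □′ := cidx □′ ∈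
(cidx □)^{∼1}`, `ν := 3^d` (`card_filter_mem_tball_le`), start cubes `{□ : cidx □ ∈ (czmap M₀ N_c Δ_x)^{∼1}}`, and §2.
[cite: Dimock2004QED3TorusII, §3.2 Thm 1 (132)–(135) p.22 L2–21, Remark 3 p.22 L28–30, proof Parts I and III p.23 L1–58, p.24 L59 – p.25 L12] -/
theorem dimock_thm1_torus [CompleteSpace E] {θ c : ℝ} {P₀ Q : X → X → ℝ}
    (hmod : Nb = M₀ * Nc) (β : X → TPt d Nb) (ctr : TPt d Nb → X) (hctr : ∀ b, β (ctr b) = b)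
    (cidx : Z → TPt d Nc) (hcidx : Function.Injective cidx) (c₀ : Pt d) (hc₀ : ∀ i, 0 ≤ c₀ i ∧ c₀ i < M₀)
    (anc : TPt d Nc → TPt d Nb) (hanc : ∀ w, anc w = proj Nb fun i => (M₀ : ℤ) * natLift w i + c₀ i)
    (hθ : 0 ≤ θ) (hc : 0 < c) (hQ0 : ∀ u v, 0 ≤ Q u v) (hP₀0 : ∀ u v, 0 ≤ P₀ u v)
    (hconv : ∀ (b : TPt d Nb) (u v : X),
      ∑ y ∈ univ.filter (fun u => β u = b), (1 : ℝ) * (Q u y * Q y v) ≤ θ * Q u v)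
    (hconv₀ : ∀ (b : TPt d Nb) (u v : X),
      ∑ y ∈ univ.filter (fun u => β u = b), (1 : ℝ) * (P₀ u y * Q y v) ≤ θ * P₀ u v)
    (φ : Z → X → E) (H : Z → Matrix X X E) (hH : ∀ z, H z = Matrix.diagonal (φ z)) {Rb ρb : ℕ}
    (hφ : ∀ z x, φ z x ≠ 0 → β x ∈ tball (anc (cidx z)) Rb)
    (A : Matrix X X E) (hA : ∀ x y, A x y ≠ 0 → β y ∈ tball (β x) ρb)
    (hRρ : 2 * Rb + ρb < 2 * M₀) (hRρ' : Rb + ρb < M₀)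
    (G : Z → Matrix X X E) (h125 : ∑ z, H z * H z = 1) (h136 : ∀ z, H z * A * G z = H z)
    {C₀ C₁ : ℝ} (hC₀ : 0 ≤ C₀) (hC₁ : 0 ≤ C₁)
    (h0 : ∀ z u v, ‖link0 H G z u v‖ ≤ C₀ * (P₀ u v * Real.exp (-(c * torusDist (β u) (β v)))))
    (hR : ∀ z u v, ‖linkR A H G z u v‖
      ≤ C₁ / (M₀ : ℝ) * (Q u v * Real.exp (-(c * torusDist (β u) (β v)))))
    (hlarge : 2 * (((3 ^ d : ℕ) : ℝ) * (C₁ * θ * K₁ d (c / 2))) ≤ (M₀ : ℝ)) :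
    (∀ x y, Summable fun n => (Gstar H G * Kop A H G ^ n) x y) ∧
    A * walkExpansion A H G = 1 ∧
    ∀ x y, ‖walkExpansion A H G x y‖
      ≤ 2 * ((3 ^ d : ℕ) : ℝ) * C₀ * (P₀ x y * Real.exp (-(c / 2) * torusDist (β x) (β y))) := by
  classical
  have hM₀ : 0 < M₀ := Nat.pos_of_ne_zero (NeZero.ne M₀)
  have hM₀r : (0 : ℝ) < M₀ := by exact_mod_cast hM₀
  have hRM : Rb < M₀ := by omega
  -- the start cubes of a site: those within 1 of the cube of its block
  let S : X → Finset Z := fun x => univ.filter fun z => cidx z ∈ tball (czmap M₀ Nc (β x)) 1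
  have hSfar : ∀ x, ∀ z ∉ S x, cidx z ∉ tball (czmap M₀ Nc (β x)) 1 :=
    fun x z hz hmem => hz (mem_filter.2 ⟨mem_univ _, hmem⟩)
  have hScard : ∀ x, (S x).card ≤ 3 ^ d := by
    intro x
    have h := card_filter_mem_tball_le cidx hcidx (czmap M₀ Nc (β x)) 1
    have h3 : (2 * 1 + 1) ^ d = 3 ^ d := by norm_num
    omega
  have hadjcard : ∀ z, (univ.filter fun z' => cidx z' ∈ tball (cidx z) 1).card ≤ 3 ^ d := by
    intro z
    have h := card_filter_mem_tball_le cidx hcidx (cidx z) 1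
    have h3 : (2 * 1 + 1) ^ d = 3 ^ d := by norm_num
    omega
  have hlarge' : 2 * (((3 ^ d : ℕ) : ℝ) * (C₁ * θ * K₁ d (c / 2) * Real.exp (2 * c * 0))) ≤ (M₀ : ℝ) := by
    rw [mul_zero, Real.exp_zero, mul_one]
    exact hlarge
  obtain ⟨h1, h2, h3⟩ := dimock_thm1 (fun z z' => cidx z' ∈ tball (cidx z) 1)
    (d := fun u v => torusDist (β u) (β v)) (ctr := ctr) (r := 0) (blk := β)
    hθ hc.le hQ0 hP₀0 hconv hconv₀
    (fun u v => torusDist_nonneg _ _) (fun u v => torusDist_comm' _ _) (fun u v t => torusDist_triangle _ _ _)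
    (fun u => by
      show torusDist (β u) (β (ctr (β u))) ≤ 0
      rw [hctr, torusDist_self'])
    (K := K₁ d (c / 2))
    (fun b => by
      show ∑ b', Real.exp (-(c / 2) * torusDist (β (ctr b)) (β (ctr b'))) ≤ K₁ d (c / 2)
      simp_rw [hctr]
      exact sum_exp_torusDist_le (half_pos hc) b)
    A H G h125 h136 hC₀ hC₁ hM₀r h0 hR
    (fun z z' hzz' => H_mul_Kz_eq_zero_of_far_torus hH hmod hanc hφ hA hRρ hzz')
    hadjcard
    S (fun x z hz v => link0_eq_zero_of_far_torus hH hmod hc₀ hanc hφ hRM G (hSfar x z hz) v) hScard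
    S (fun x z hz v => linkR_eq_zero_of_far_torus hH hmod hc₀ hanc hφ hA hRM hRρ' G (hSfar x z hz) v) hScard
    hlarge'
  refine ⟨h1, h2, fun x y => ?_⟩
  have h := h3 x y
  rw [mul_zero, Real.exp_zero, mul_one] at h
  calc ‖walkExpansion A H G x y‖
      ≤ 2 * ((3 ^ d : ℕ) : ℝ) * C₀ * (P₀ x y * Real.exp (-(c / 2) * torusDist (β x) (β y))) := by
        simpa [mul_assoc] using h


/-! ## §4 THEOREMS 1 and 2 on the 3-torus with the printed profiles: (154) ∕ (202)–(203) discharged -/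

open Balaban1983to89.B12Decay510Torus (vmaVec)

/-- **THEOREM 1 (132)–(135), single scale, on the 3-torus, WITH THE PRINTED PROFILES.**  `dimock_thm1_torus` at `d = 3`
with `P₀ = Q :=` the printed `d′^{−2}` of (137) ∕ (143) as a kernel against `∫dy = Ση³`, i.e.
`Q(u,v) = η³·(η·dOne(vmaVec(e u − e v)))^{−2}` for the sites embedded injectively in the site torus `(ℤ∕N_s)³` by `e`
(`η = L^{−k}` the spacing), unit blocks of at most `R³` sites: the block convolution hypotheses (154) for `(Q,Q)` and
`(P₀,Q)` are DISCHARGED by LEMMA 1 (130) on the torus (`hconv_shape_torus`, `θ = 2³C(2)(ηR)`).  Remaining hypotheses: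
(125) `h125`, (136) `h136`, the link bounds (137) `h0` and (143) `hR` in printed shape, the supports, and *"`M_0`
sufficiently large"*: `2·3³·C₁·(2³C(2)(ηR))·K₁(3,c∕2) ≤ M₀`.  Conclusion (135):
`‖S_k(A;x,y)‖ ≤ 2·3³·C₀·η³d′_T(e x,e y)^{−2}e^{−(c∕2)d(Δ_x,Δ_y)}` — the printed `O(1)d′(x,y)^{−2}exp(−O(1)d(x,y))`.
[cite: Dimock2004QED3TorusII, §3.2 Thm 1 (132)–(135) p.22 L2–21, Remark 3 p.22 L28–30, Lemma 2 (137) p.22 L43–45, proof Part II (143) p.23 L59–65, Part III (152)–(155) p.24 L59 – p.25 L12; §3.1 Lemma 1 (130) p.21 L40–42] -/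
theorem dimock_thm1_torus_dprime [CompleteSpace E] {c η : ℝ} {Ns R : ℕ} [NeZero Ns]
    (hmod : Nb = M₀ * Nc) (e : X → TPt 3 Ns) (he : Function.Injective e)
    (β : X → TPt 3 Nb) (ctr : TPt 3 Nb → X) (hctr : ∀ b, β (ctr b) = b)
    (hblk : ∀ b, (univ.filter fun u => β u = b).card ≤ R ^ 3) (hR : 1 ≤ R) (hη : 0 < η)
    (cidx : Z → TPt 3 Nc) (hcidx : Function.Injective cidx) (c₀ : Pt 3) (hc₀ : ∀ i, 0 ≤ c₀ i ∧ c₀ i < M₀)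
    (anc : TPt 3 Nc → TPt 3 Nb) (hanc : ∀ w, anc w = proj Nb fun i => (M₀ : ℤ) * natLift w i + c₀ i)
    (hc : 0 < c)
    (φ : Z → X → E) (H : Z → Matrix X X E) (hH : ∀ z, H z = Matrix.diagonal (φ z)) {Rb ρb : ℕ}
    (hφ : ∀ z x, φ z x ≠ 0 → β x ∈ tball (anc (cidx z)) Rb)
    (A : Matrix X X E) (hA : ∀ x y, A x y ≠ 0 → β y ∈ tball (β x) ρb)
    (hRρ : 2 * Rb + ρb < 2 * M₀) (hRρ' : Rb + ρb < M₀)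
    (G : Z → Matrix X X E) (h125 : ∑ z, H z * H z = 1) (h136 : ∀ z, H z * A * G z = H z)
    {C₀ C₁ : ℝ} (hC₀ : 0 ≤ C₀) (hC₁ : 0 ≤ C₁)
    (h0 : ∀ z u v, ‖link0 H G z u v‖ ≤ C₀ * ((η ^ 3 * (η * dOne (vmaVec (e u - e v))) ^ (-(2 : ℝ)))
      * Real.exp (-(c * torusDist (β u) (β v)))))
    (hR' : ∀ z u v, ‖linkR A H G z u v‖ ≤ C₁ / (M₀ : ℝ) * ((η ^ 3 * (η * dOne (vmaVec (e u - e v))) ^ (-(2 : ℝ)))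
      * Real.exp (-(c * torusDist (β u) (β v)))))
    (hlarge : 2 * (((3 ^ 3 : ℕ) : ℝ) *
        (C₁ * (2 ^ ((2 : ℝ) + 1) * blockConst 2 * (η * R) ^ ((3 : ℝ) - 2)) * K₁ 3 (c / 2))) ≤ (M₀ : ℝ)) :
    (∀ x y, Summable fun n => (Gstar H G * Kop A H G ^ n) x y) ∧
    A * walkExpansion A H G = 1 ∧
    ∀ x y, ‖walkExpansion A H G x y‖
      ≤ 2 * ((3 ^ 3 : ℕ) : ℝ) * C₀ * ((η ^ 3 * (η * dOne (vmaVec (e x - e y))) ^ (-(2 : ℝ)))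
          * Real.exp (-(c / 2) * torusDist (β x) (β y))) := by
  have hθ : 0 ≤ 2 ^ ((2 : ℝ) + 1) * blockConst 2 * (η * R) ^ ((3 : ℝ) - 2) :=
    mul_nonneg (mul_nonneg (Real.rpow_nonneg zero_le_two _) (zero_le_one.trans (one_le_blockConst (α := 2) (by norm_num))))
      (Real.rpow_nonneg (mul_nonneg hη.le (Nat.cast_nonneg R)) _)
  have hQ0 : ∀ u v : X, 0 ≤ η ^ 3 * (η * dOne (vmaVec (e u - e v))) ^ (-(2 : ℝ)) := fun u v =>
    mul_nonneg (pow_nonneg hη.le 3) (Real.rpow_nonneg (dprimeT_pos hη (e u) (e v)).le _)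
  exact dimock_thm1_torus hmod β ctr hctr cidx hcidx c₀ hc₀ anc hanc hθ hc hQ0 hQ0
    (hconv_shape_torus e he β hη hR hblk) (hconv_shape_torus e he β hη hR hblk)
    φ H hH hφ A hA hRρ hRρ' G h125 h136 hC₀ hC₁ h0 hR' hlarge



/-- **THEOREM 2 (195), single scale, on the 3-torus, WITH THE PRINTED BOSON PROFILES** (§3.3: *"Now we follow the
proof of theorem 1. The only difference is in the short distance estimates … Instead of (154) we have by (129), (130),
(131) … (202) … In the last step … (203)"*).  `dimock_thm1_torus` at `d = 3` with the first-link profile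
`P₀ = η³·d′_T^{−1}` ((198)) and the later-link profile `Q = η³·(d′_T^{−1} + d′_T^{−2})` ((201) on one scale), the block
convolution hypotheses (202) for `(Q,Q)` and (203) for `(P₀,Q)` DISCHARGED on the torus (`hconv_shape_torus_boson`,
`hconv₀_shape_torus_boson`, `θ′ = 4C(1)(ηR)² + 2√8C(2)(ηR) + 8C(2)(ηR)`).  Remaining hypotheses: (125) `h125`, (197) `h136`,
the link bounds (198) `h0` and (201) `hR` in printed shape (LEMMA 3 and the commutator step), the supports, and *"Let `M_0`
be sufficiently large"*: `2·3³·C₁θ′K₁(3,c∕2) ≤ M₀`.  Conclusion (195):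
`‖G_k(x,y)‖ ≤ 2·3³·C₀·η³d′_T(e x,e y)^{−1}e^{−(c∕2)d(Δ_x,Δ_y)}` — the printed `O(1)d′(x,y)^{−1}exp(−O(1)d(x,y))`.
[cite: Dimock2004QED3TorusII, §3.3 Thm 2 (194)–(195) p.29 L55 – p.30 L5, Lemma 3 (197)–(198) p.30 L14–22, proof (199)–(203) p.30 L24 – p.31 L6; §3.1 Lemma 1 (129)–(131) p.21 L36–45] -/
theorem dimock_thm2_torus_dprime [CompleteSpace E] {c η : ℝ} {Ns R : ℕ} [NeZero Ns]
    (hmod : Nb = M₀ * Nc) (e : X → TPt 3 Ns) (he : Function.Injective e)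
    (β : X → TPt 3 Nb) (ctr : TPt 3 Nb → X) (hctr : ∀ b, β (ctr b) = b)
    (hblk : ∀ b, (univ.filter fun u => β u = b).card ≤ R ^ 3) (hR : 1 ≤ R) (hη : 0 < η)
    (cidx : Z → TPt 3 Nc) (hcidx : Function.Injective cidx) (c₀ : Pt 3) (hc₀ : ∀ i, 0 ≤ c₀ i ∧ c₀ i < M₀)
    (anc : TPt 3 Nc → TPt 3 Nb) (hanc : ∀ w, anc w = proj Nb fun i => (M₀ : ℤ) * natLift w i + c₀ i)
    (hc : 0 < c)
    (φ : Z → X → E) (H : Z → Matrix X X E) (hH : ∀ z, H z = Matrix.diagonal (φ z)) {Rb ρb : ℕ}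
    (hφ : ∀ z x, φ z x ≠ 0 → β x ∈ tball (anc (cidx z)) Rb)
    (A : Matrix X X E) (hA : ∀ x y, A x y ≠ 0 → β y ∈ tball (β x) ρb)
    (hRρ : 2 * Rb + ρb < 2 * M₀) (hRρ' : Rb + ρb < M₀)
    (G : Z → Matrix X X E) (h125 : ∑ z, H z * H z = 1) (h136 : ∀ z, H z * A * G z = H z)
    {C₀ C₁ : ℝ} (hC₀ : 0 ≤ C₀) (hC₁ : 0 ≤ C₁)
    (h0 : ∀ z u v, ‖link0 H G z u v‖ ≤ C₀ * ((η ^ 3 * (η * dOne (vmaVec (e u - e v))) ^ (-(1 : ℝ)))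
      * Real.exp (-(c * torusDist (β u) (β v)))))
    (hR' : ∀ z u v, ‖linkR A H G z u v‖ ≤ C₁ / (M₀ : ℝ) *
      ((η ^ 3 * ((η * dOne (vmaVec (e u - e v))) ^ (-(1 : ℝ)) + (η * dOne (vmaVec (e u - e v))) ^ (-(2 : ℝ))))
        * Real.exp (-(c * torusDist (β u) (β v)))))
    (hlarge : 2 * (((3 ^ 3 : ℕ) : ℝ) *
        (C₁ * (2 ^ ((1 : ℝ) + 1) * blockConst 1 * (η * R) ^ ((3 : ℝ) - 1)
          + 2 * (Real.sqrt 8 * blockConst 2 * (η * R))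
          + 2 ^ ((2 : ℝ) + 1) * blockConst 2 * (η * R) ^ ((3 : ℝ) - 2)) * K₁ 3 (c / 2))) ≤ (M₀ : ℝ)) :
    (∀ x y, Summable fun n => (Gstar H G * Kop A H G ^ n) x y) ∧
    A * walkExpansion A H G = 1 ∧
    ∀ x y, ‖walkExpansion A H G x y‖
      ≤ 2 * ((3 ^ 3 : ℕ) : ℝ) * C₀ * ((η ^ 3 * (η * dOne (vmaVec (e x - e y))) ^ (-(1 : ℝ)))
          * Real.exp (-(c / 2) * torusDist (β x) (β y))) := by
  have hηR : 0 ≤ η * R := mul_nonneg hη.le (Nat.cast_nonneg R)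
  have hC1 : 0 ≤ blockConst 1 := zero_le_one.trans (one_le_blockConst (α := 1) (by norm_num))
  have hC2 : 0 ≤ blockConst 2 := zero_le_one.trans (one_le_blockConst (α := 2) (by norm_num))
  have hθ : 0 ≤ 2 ^ ((1 : ℝ) + 1) * blockConst 1 * (η * R) ^ ((3 : ℝ) - 1)
      + 2 * (Real.sqrt 8 * blockConst 2 * (η * R)) + 2 ^ ((2 : ℝ) + 1) * blockConst 2 * (η * R) ^ ((3 : ℝ) - 2) := by
    positivity
  have hQ0 : ∀ u v : X, 0 ≤ η ^ 3 * ((η * dOne (vmaVec (e u - e v))) ^ (-(1 : ℝ))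
      + (η * dOne (vmaVec (e u - e v))) ^ (-(2 : ℝ))) := fun u v =>
    mul_nonneg (pow_nonneg hη.le 3) (add_nonneg (Real.rpow_nonneg (dprimeT_pos hη (e u) (e v)).le _)
      (Real.rpow_nonneg (dprimeT_pos hη (e u) (e v)).le _))
  have hP₀0 : ∀ u v : X, 0 ≤ η ^ 3 * (η * dOne (vmaVec (e u - e v))) ^ (-(1 : ℝ)) := fun u v =>
    mul_nonneg (pow_nonneg hη.le 3) (Real.rpow_nonneg (dprimeT_pos hη (e u) (e v)).le _)
  exact dimock_thm1_torus hmod β ctr hctr cidx hcidx c₀ hc₀ anc hanc hθ hc hQ0 hP₀0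
    (hconv_shape_torus_boson e he β hη hR hblk) (hconv₀_shape_torus_boson e he β hη hR hblk)
    φ H hH hφ A hA hRρ hRρ' G h125 h136 hC₀ hC₁ h0 hR' hlarge

/-! ## §5 THEOREM 1 on the 3-torus with `h_□ :=` the printed (124) periodized: (125) and the supports discharged -/

open QED3SquarePartition (g)

/-- **(125) as the operator identity `Σ_□h_□h_□ = 1` ON THE TORUS** for the multiplication operators by the periodized (124)
(`QED3TorusPartitionOfUnity.sum_sq_g_torus_eq_one`), summed over all cubes `w ∈ (ℤ∕N_c)^d`, at every site of any site set
mapped into the site torus. [cite: Dimock2004QED3TorusII, §3.1 (124)–(125) p.20 L82 – p.21 L4 and §3.2 Thm 1 proof Part I (139) p.23 L9–17 («thanks to (125) and (136)»)] -/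
theorem h125_torus {dd : ℕ} {Ns Nc' ℓ : ℕ} [NeZero Ns] [NeZero Nc'] [NeZero ℓ] (hmod : Ns = ℓ * Nc') (t : ℝ)
    (hNc : 2 * |t| + 6 / 5 < (Nc' : ℝ)) {cz : TPt dd Nc' → TPt dd Ns}
    (hcz : ∀ w, cz w = proj Ns fun i => (ℓ : ℤ) * natLift w i) (e : X → TPt dd Ns)
    (H : TPt dd Nc' → Matrix X X E)
    (hH : ∀ w, H w = Matrix.diagonal fun x =>
      algebraMap ℝ E (g (fun i => (ℓ : ℝ)⁻¹ * (((e x - cz w) i).valMinAbs : ℝ) - t))) :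
    ∑ w, H w * H w = 1 := by
  classical
  have he : ∀ w, H w * H w = Matrix.diagonal fun x =>
      algebraMap ℝ E (g (fun i => (ℓ : ℝ)⁻¹ * (((e x - cz w) i).valMinAbs : ℝ) - t) ^ 2) := by
    intro w
    rw [hH w, Matrix.diagonal_mul_diagonal]
    congr 1
    funext x
    rw [← map_mul, sq]
  simp_rw [he]
  ext i j
  rw [Matrix.sum_apply, Matrix.one_apply]
  simp_rw [Matrix.diagonal_apply]
  split_ifs with hij
  · rw [← map_sum, sum_sq_g_torus_eq_one hmod t hNc hcz (e i), map_one]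
  · exact sum_const_zero

omit [NeZero Nc] [NeZero M₀] in
/-- the anchor of the periodized (124): the block of the centre site `cz w + τ` of cube `w` is `M₀·w + τ∕ℓ_b` on the block
torus (`N_s = ℓ_bN_b`, `ℓ = ℓ_bM₀`, `0 ≤ τ < ℓ`). [cite: Dimock2004QED3TorusII, §3.1 (124), (126) p.20 L85 – p.21 L15] -/
theorem czmap_centre_site {Ns ℓb : ℕ} [NeZero Ns] [NeZero ℓb] (hmodS : Ns = ℓb * Nb) (τ : ℤ)
    {cz : TPt 3 Nc → TPt 3 Ns} (hcz : ∀ w, cz w = proj Ns fun i => ((ℓb * M₀ : ℕ) : ℤ) * natLift w i)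
    (w : TPt 3 Nc) :
    czmap ℓb Nb (cz w + proj Ns fun _ => τ) = proj Nb fun i => (M₀ : ℤ) * natLift w i + τ / ℓb := by
  have hℓb : 0 < ℓb := Nat.pos_of_ne_zero (NeZero.ne ℓb)
  have hℓbz : (0 : ℤ) < ℓb := by exact_mod_cast hℓb
  rw [hcz w, ← proj_add, czmap_proj hmodS]
  congr 1
  refine (coarse_eq_iff hℓb _ _).2 fun i => ?_
  simp only [Pi.add_apply, Nat.cast_mul]
  have h1 := Int.ediv_mul_le τ hℓbz.ne'
  have h2 := Int.lt_ediv_add_one_mul_self τ hℓbz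
  constructor
  · nlinarith
  · nlinarith

/-- **THEOREM 1 (132)–(135), single scale, on the 3-torus, with `h_□ :=` THE PRINTED (124) periodized and the profiles
`d′^{−2}`: (125), (154), the supports and the adjacency ALL DERIVED.**  Data: the site torus `(ℤ∕N_s)³`
(`η = L^{−k}`), unit blocks of `ℓ_b` sites (`N_s = ℓ_bN_b`, the block map `czmap ℓ_b N_b`, `≤ R³` sites of `X` per block),
cubes of `M₀` blocks (`N_b = M₀N_c`, `ℓ = ℓ_bM₀`, `N_c ≥ 3`), sites `X` embedded injectively by `e`; the multiplication
operators `H w = diagonal(x ↦ g(ℓ^{−1}·valMinAbs(e x − cz w) − t))` over all cubes `w ∈ (ℤ∕N_c)³` (the centre offset `t`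
within `1∕(2ℓ)` of `τ∕ℓ`, `0 ≤ τ < ℓ`, `2|t| + 6∕5 < N_c`); the operator `A` of SITE range `ρ_s` (`A(x,y) ≠ 0 ⟹ e y ∈ (e x)^{∼ρ_s}`);
(136); the link bounds (137) ∕ (143) with the profile `η³d′_T(e u,e v)^{−2}` and decay `e^{−c·d(Δ_u,Δ_v)}`; and the
explicit largeness ∕ range arithmetic with `R_b = r∕ℓ_b + 1` (`r ≥ (3∕5)ℓ + 1∕2` an integer support radius),
`ρ_b = ρ_s∕ℓ_b + 1`: `2R_b + ρ_b < 2M₀`, `R_b + ρ_b < M₀`, `2·3³·C₁·(2³C(2)(ηR))·K₁(3,c∕2) ≤ M₀`.  THEN every entry series of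
the walk expansion converges, `A·S_k(A) = 1`, and (135)
`‖S_k(A;x,y)‖ ≤ 2·3³·C₀·η³d′_T(e x,e y)^{−2}e^{−(c∕2)d(Δ_x,Δ_y)}`.  Hypotheses left: (136), (137), (143) — LEMMA 2 and Part II.
[cite: Dimock2004QED3TorusII, §3.2 Thm 1 (132)–(135) p.22 L2–21, Remark 3 p.22 L28–30, Lemma 2 (136)–(137) p.22 L32–47, proof Parts I–III p.23 L1 – p.25 L12; §3.1 (124)–(126) p.20 L82 – p.21 L15, Lemma 1 (130) p.21 L40–42] -/
theorem dimock_thm1_torus_printed [CompleteSpace E] {c η t : ℝ} {Ns ℓb R r ρs : ℕ} {τ : ℤ} [NeZero Ns] [NeZero ℓb]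
    (hmod : Nb = M₀ * Nc) (hmodS : Ns = ℓb * Nb) (hNc : 2 * |t| + 6 / 5 < (Nc : ℝ))
    (e : X → TPt 3 Ns) (he : Function.Injective e)
    (β : X → TPt 3 Nb) (hβ : ∀ x, β x = czmap ℓb Nb (e x)) (ctr : TPt 3 Nb → X) (hctr : ∀ b, β (ctr b) = b)
    (hblk : ∀ b, (univ.filter fun u => β u = b).card ≤ R ^ 3) (hR : 1 ≤ R) (hη : 0 < η) (hc : 0 < c)
    {cz : TPt 3 Nc → TPt 3 Ns} (hcz : ∀ w, cz w = proj Ns fun i => ((ℓb * M₀ : ℕ) : ℤ) * natLift w i)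
    (hτ0 : 0 ≤ τ) (hτℓ : τ < (ℓb * M₀ : ℕ)) (hτ : |((ℓb * M₀ : ℕ) : ℝ) * t - τ| ≤ 1 / 2)
    (hr : (3 / 5 : ℝ) * ((ℓb * M₀ : ℕ) : ℝ) + 1 / 2 ≤ r)
    (H : TPt 3 Nc → Matrix X X E)
    (hH : ∀ w, H w = Matrix.diagonal fun x =>
      algebraMap ℝ E (g (fun i => (((ℓb * M₀ : ℕ) : ℝ))⁻¹ * (((e x - cz w) i).valMinAbs : ℝ) - t)))
    (A : Matrix X X E) (hA : ∀ x y, A x y ≠ 0 → e y ∈ tball (e x) ρs)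
    (hRρ : 2 * (r / ℓb + 1) + (ρs / ℓb + 1) < 2 * M₀) (hRρ' : (r / ℓb + 1) + (ρs / ℓb + 1) < M₀)
    (G : TPt 3 Nc → Matrix X X E) (h136 : ∀ w, H w * A * G w = H w)
    {C₀ C₁ : ℝ} (hC₀ : 0 ≤ C₀) (hC₁ : 0 ≤ C₁)
    (h0 : ∀ w u v, ‖link0 H G w u v‖ ≤ C₀ * ((η ^ 3 * (η * dOne (vmaVec (e u - e v))) ^ (-(2 : ℝ)))
      * Real.exp (-(c * torusDist (β u) (β v)))))
    (hR' : ∀ w u v, ‖linkR A H G w u v‖ ≤ C₁ / (M₀ : ℝ) * ((η ^ 3 * (η * dOne (vmaVec (e u - e v))) ^ (-(2 : ℝ)))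
      * Real.exp (-(c * torusDist (β u) (β v)))))
    (hlarge : 2 * (((3 ^ 3 : ℕ) : ℝ) *
        (C₁ * (2 ^ ((2 : ℝ) + 1) * blockConst 2 * (η * R) ^ ((3 : ℝ) - 2)) * K₁ 3 (c / 2))) ≤ (M₀ : ℝ)) :
    (∀ x y, Summable fun n => (Gstar H G * Kop A H G ^ n) x y) ∧
    A * walkExpansion A H G = 1 ∧
    ∀ x y, ‖walkExpansion A H G x y‖
      ≤ 2 * ((3 ^ 3 : ℕ) : ℝ) * C₀ * ((η ^ 3 * (η * dOne (vmaVec (e x - e y))) ^ (-(2 : ℝ)))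
          * Real.exp (-(c / 2) * torusDist (β x) (β y))) := by
  classical
  have hℓ : NeZero (ℓb * M₀) := ⟨Nat.mul_ne_zero (NeZero.ne ℓb) (NeZero.ne M₀)⟩
  have hℓb : 0 < ℓb := Nat.pos_of_ne_zero (NeZero.ne ℓb)
  have hℓbz : (0 : ℤ) < ℓb := by exact_mod_cast hℓb
  have hmodS' : Ns = (ℓb * M₀) * Nc := by rw [hmodS, hmod, Nat.mul_assoc]
  -- the anchors: the blocks of the centre sites `cz w + τ`
  set anc : TPt 3 Nc → TPt 3 Nb := fun w => czmap ℓb Nb (cz w + proj Ns fun _ => τ) with hanc_def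
  have hanc : ∀ w, anc w = proj Nb fun i => (M₀ : ℤ) * natLift w i + (fun _ : Fin 3 => τ / ℓb) i :=
    fun w => czmap_centre_site (Nb := Nb) (M₀ := M₀) hmodS τ hcz w
  have hc₀ : ∀ i : Fin 3, 0 ≤ (fun _ : Fin 3 => τ / (ℓb : ℤ)) i ∧ (fun _ : Fin 3 => τ / (ℓb : ℤ)) i < M₀ := by
    intro i
    refine ⟨Int.ediv_nonneg hτ0 hℓbz.le, ?_⟩
    show τ / (ℓb : ℤ) < M₀
    rw [Int.ediv_lt_iff_lt_mul hℓbz]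
    have : ((ℓb * M₀ : ℕ) : ℤ) = (M₀ : ℤ) * ℓb := by push_cast; ring
    rw [← this]
    exact_mod_cast hτℓ
  -- the support of `h_w` at block level: `β x ∈ (anc w)^{∼(r∕ℓ_b + 1)}`
  have hφ : ∀ w x, algebraMap ℝ E (g (fun i => (((ℓb * M₀ : ℕ) : ℝ))⁻¹ * (((e x - cz w) i).valMinAbs : ℝ) - t)) ≠ 0 →
      β x ∈ tball (anc w) (r / ℓb + 1) := by
    intro w x hx
    have hx' : g (fun i => (((ℓb * M₀ : ℕ) : ℝ))⁻¹ * (((e x - cz w) i).valMinAbs : ℝ) - t) ≠ 0 :=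
      fun h0 => hx (by rw [h0, map_zero])
    have h1 : e x ∈ tball (cz w + proj Ns fun _ => τ) r :=
      mem_tball_of_g_torus_ne_zero (ℓ := ℓb * M₀) hτ hr cz w (e x) hx'
    have h2 := czmap_mem_tball (Ls := ℓb) (Nc := Nb) hmodS h1
    rw [← hβ x] at h2
    exact h2
  -- the range of `A` at block level
  have hA' : ∀ x y, A x y ≠ 0 → β y ∈ tball (β x) (ρs / ℓb + 1) := by
    intro x y hxy
    have h2 := czmap_mem_tball (Ls := ℓb) (Nc := Nb) hmodS (hA x y hxy)
    rw [← hβ x, ← hβ y] at h2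
    exact h2
  exact dimock_thm1_torus_dprime hmod e he β ctr hctr hblk hR hη (fun w => w) (fun _ _ h => h)
    (fun _ => τ / (ℓb : ℤ)) hc₀ anc hanc hc
    (fun w x => algebraMap ℝ E (g (fun i => (((ℓb * M₀ : ℕ) : ℝ))⁻¹ * (((e x - cz w) i).valMinAbs : ℝ) - t)))
    H hH hφ A hA' hRρ hRρ' G (h125_torus hmodS' t hNc hcz e H hH) h136 hC₀ hC₁ h0 hR' hlarge

end Theorem1

end QED3TorusII

end Literature.MathematicalPhysics.QuantumFieldTheory.Dimock2011to13
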